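import Summits.BirchSwinnertonDyer.BirchSwinnertonDyer.Theses.KimAtThreeKolyvagin
import HarnessLib

/-! # BC3 birth skeleton — crux `KimAtThreeKolyvagin.StubAtEmptyLevelThree` (stmt-BirchSwinnertonDyer-19561)
Planner bsd-addord-plan g15.  The stub at the EMPTY level at `p = 3`: for the generator `g` of
`KS(E[3^{k+1}], 𝓕_can)` and `#H¹_{𝓕_can} = 3^{k+1} · 3^{n₀}`, `g_∅ ∈ 3^{n₀} H¹_{𝓕_can} + H¹_𝓚`
(Mazur–Rubin 2004 Thm 4.4.1 / Sakamoto 2024 Thm 4.4 (2) at `d = ∅`, where `3^{n₀} = #H¹_{𝓕_can^*}(T^*)`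
by the core-rank-one Euler characteristic).  Seam = SAKAMOTO'S OWN CASE SPLIT in Thm 4.4 (2):
`stub_shallowCase` (`n₀ ≤ k`, i.e. `#N_∅ ∣ 3^{k+1}` properly: `ord(g_∅) · #N_∅ = 3^{k+1}` and the
`ℤ/3^{k+1}`-structure of `H¹_{𝓕_can}/H¹_𝓚` through `Λ` places `g_∅` in `3^{n₀}H¹_{𝓕_can} + H¹_𝓚`) and
`stub_deepCase` (`k + 1 ≤ n₀`, i.e. `3^{k+1} ∣ #N_∅`: then `g_∅ = 0` — the generator dies at the empty
level at this depth, the conclusion holds with `e = m = 0`; content = the vanishing clause + the PT count).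
`StubAtEmptyLevelThree_of` is the kernel-checked case split on `n₀ < k + 1 ∨ k + 1 ≤ n₀`; sorries ONLY in
the two stubs. -/

set_option autoImplicit false

noncomputable section

namespace Summit.BirchSwinnertonDyer.BirchSwinnertonDyer.Cruxes.StubAtEmptyLevelThree.Birth

open scoped Classical NumberField ContRepresentation
open Field NumberField IsDedekindDomain WeierstrassCurve
  Literature.NumberTheory.EllipticCurves
  Literature.NumberTheory.GaloisRepresentations
  Literature.NumberTheory.GaloisRepresentations.DiscreteGaloisModule Literature.NumberTheory.GaloisCohomology
  Summit.BirchSwinnertonDyer.Rank1Residual.GaloisImage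

/-- stub 1 — the SHALLOW case `n₀ ≤ k` (`#H¹_{𝓕_can^*}(T^*) ∣ 3^{k+1}` properly; Sakamoto Thm 4.4 (2),
first clause, + the `Λ`-structure of `H¹_{𝓕_can}/H¹_𝓚`). -/
theorem stub_shallowCase :
    ∀ (W : WeierstrassCurve ℚ) [W.IsElliptic] [W.IsGloballyMinimal],
      (∀ m : ℕ, W.HasSurjectiveModNGaloisRep (3 ^ m : ℕ)) →
      ∀ (η : (q : HeightOneSpectrum (𝓞 ℚ)) → (ZMod (Ideal.absNorm q.asIdeal))ˣ),
        (∀ q, Subgroup.zpowers (η q) = ⊤) →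
      ∀ (k : ℕ) (Dk : KolyvaginDatum (W.torsionGaloisModule (((3 : ℕ) : ℤ) ^ k * ((3 : ℕ) : ℤ))))
        (g : Finset (HeightOneSpectrum (𝓞 ℚ)) →
          galoisCohomology (W.torsionGaloisModule (((3 : ℕ) : ℤ) ^ k * ((3 : ℕ) : ℤ))) 1)
        (n₀ : ℕ), Dk.IsCanonicalTauDatumThreeAtWith W k k η →
        g ∈ Dk.kolyvaginSystems (propagatedSelmerStructure W 3 k) →
        (∀ κ ∈ Dk.kolyvaginSystems (propagatedSelmerStructure W 3 k), ∃ a : ℕ, κ = a • g) →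
        Nat.card (propagatedSelmerStructure W 3 k).selmerGroup = 3 ^ (k + 1) * 3 ^ n₀ →
        n₀ ≤ k →
        ∃ e ∈ (propagatedSelmerStructure W 3 k).selmerGroup,
          ∃ m ∈ (W.kummerSelmerStructure (((3 : ℕ) : ℤ) ^ k * ((3 : ℕ) : ℤ))).selmerGroup,
            g ∅ = 3 ^ n₀ • e + m := by
  sorry

/-- stub 2 — the DEEP case `k + 1 ≤ n₀` (`3^{k+1} ∣ #H¹_{𝓕_can^*}(T^*)`; Sakamoto Thm 4.4 (2), second
clause: the generator vanishes at the empty level at this depth). -/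
theorem stub_deepCase :
    ∀ (W : WeierstrassCurve ℚ) [W.IsElliptic] [W.IsGloballyMinimal],
      (∀ m : ℕ, W.HasSurjectiveModNGaloisRep (3 ^ m : ℕ)) →
      ∀ (η : (q : HeightOneSpectrum (𝓞 ℚ)) → (ZMod (Ideal.absNorm q.asIdeal))ˣ),
        (∀ q, Subgroup.zpowers (η q) = ⊤) →
      ∀ (k : ℕ) (Dk : KolyvaginDatum (W.torsionGaloisModule (((3 : ℕ) : ℤ) ^ k * ((3 : ℕ) : ℤ))))
        (g : Finset (HeightOneSpectrum (𝓞 ℚ)) →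
          galoisCohomology (W.torsionGaloisModule (((3 : ℕ) : ℤ) ^ k * ((3 : ℕ) : ℤ))) 1)
        (n₀ : ℕ), Dk.IsCanonicalTauDatumThreeAtWith W k k η →
        g ∈ Dk.kolyvaginSystems (propagatedSelmerStructure W 3 k) →
        (∀ κ ∈ Dk.kolyvaginSystems (propagatedSelmerStructure W 3 k), ∃ a : ℕ, κ = a • g) →
        Nat.card (propagatedSelmerStructure W 3 k).selmerGroup = 3 ^ (k + 1) * 3 ^ n₀ →
        k + 1 ≤ n₀ →
        ∃ e ∈ (propagatedSelmerStructure W 3 k).selmerGroup,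
          ∃ m ∈ (W.kummerSelmerStructure (((3 : ℕ) : ℤ) ^ k * ((3 : ℕ) : ℤ))).selmerGroup,
            g ∅ = 3 ^ n₀ • e + m := by
  sorry

/-- COMPOSITION (kernel-checked): the two cases give the crux BY NAME. -/
theorem StubAtEmptyLevelThree_of
    (h₁ :
    ∀ (W : WeierstrassCurve ℚ) [W.IsElliptic] [W.IsGloballyMinimal],
      (∀ m : ℕ, W.HasSurjectiveModNGaloisRep (3 ^ m : ℕ)) →
      ∀ (η : (q : HeightOneSpectrum (𝓞 ℚ)) → (ZMod (Ideal.absNorm q.asIdeal))ˣ),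
        (∀ q, Subgroup.zpowers (η q) = ⊤) →
      ∀ (k : ℕ) (Dk : KolyvaginDatum (W.torsionGaloisModule (((3 : ℕ) : ℤ) ^ k * ((3 : ℕ) : ℤ))))
        (g : Finset (HeightOneSpectrum (𝓞 ℚ)) →
          galoisCohomology (W.torsionGaloisModule (((3 : ℕ) : ℤ) ^ k * ((3 : ℕ) : ℤ))) 1)
        (n₀ : ℕ), Dk.IsCanonicalTauDatumThreeAtWith W k k η →
        g ∈ Dk.kolyvaginSystems (propagatedSelmerStructure W 3 k) →
        (∀ κ ∈ Dk.kolyvaginSystems (propagatedSelmerStructure W 3 k), ∃ a : ℕ, κ = a • g) →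
        Nat.card (propagatedSelmerStructure W 3 k).selmerGroup = 3 ^ (k + 1) * 3 ^ n₀ →
        n₀ ≤ k →
        ∃ e ∈ (propagatedSelmerStructure W 3 k).selmerGroup,
          ∃ m ∈ (W.kummerSelmerStructure (((3 : ℕ) : ℤ) ^ k * ((3 : ℕ) : ℤ))).selmerGroup,
            g ∅ = 3 ^ n₀ • e + m)
    (h₂ :
    ∀ (W : WeierstrassCurve ℚ) [W.IsElliptic] [W.IsGloballyMinimal],
      (∀ m : ℕ, W.HasSurjectiveModNGaloisRep (3 ^ m : ℕ)) →
      ∀ (η : (q : HeightOneSpectrum (𝓞 ℚ)) → (ZMod (Ideal.absNorm q.asIdeal))ˣ),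
        (∀ q, Subgroup.zpowers (η q) = ⊤) →
      ∀ (k : ℕ) (Dk : KolyvaginDatum (W.torsionGaloisModule (((3 : ℕ) : ℤ) ^ k * ((3 : ℕ) : ℤ))))
        (g : Finset (HeightOneSpectrum (𝓞 ℚ)) →
          galoisCohomology (W.torsionGaloisModule (((3 : ℕ) : ℤ) ^ k * ((3 : ℕ) : ℤ))) 1)
        (n₀ : ℕ), Dk.IsCanonicalTauDatumThreeAtWith W k k η →
        g ∈ Dk.kolyvaginSystems (propagatedSelmerStructure W 3 k) →
        (∀ κ ∈ Dk.kolyvaginSystems (propagatedSelmerStructure W 3 k), ∃ a : ℕ, κ = a • g) →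
        Nat.card (propagatedSelmerStructure W 3 k).selmerGroup = 3 ^ (k + 1) * 3 ^ n₀ →
        k + 1 ≤ n₀ →
        ∃ e ∈ (propagatedSelmerStructure W 3 k).selmerGroup,
          ∃ m ∈ (W.kummerSelmerStructure (((3 : ℕ) : ℤ) ^ k * ((3 : ℕ) : ℤ))).selmerGroup,
            g ∅ = 3 ^ n₀ • e + m) :
    Summit.BirchSwinnertonDyer.BirchSwinnertonDyer.Theses.KimAtThreeKolyvagin.StubAtEmptyLevelThree := by
  intro W _ _ htow η hη k Dk g n₀ hcan hg hgen hcard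
  rcases Nat.lt_or_ge n₀ (k + 1) with h | h
  · exact h₁ W htow η hη k Dk g n₀ hcan hg hgen hcard (Nat.lt_succ_iff.mp h)
  · exact h₂ W htow η hη k Dk g n₀ hcan hg hgen hcard h

end Summit.BirchSwinnertonDyer.BirchSwinnertonDyer.Cruxes.StubAtEmptyLevelThree.Birth

end
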